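import Summits.QuantumFields.YangMills.Theorems.BalabanUVNodesN19LedgerDressAtRecordUnit
import Literature.MathematicalPhysics.QuantumFieldTheory.Balaban1983to89.Node00.Record13CoP
import Literature.MathematicalPhysics.QuantumFieldTheory.Balaban1983to89.Node00.Record13CoPR
import Literature.MathematicalPhysics.QuantumFieldTheory.Balaban1983to89.Node00.Record13CoPH

/-!
# BalabanUVNodes ∕ N19 (NE7 proper) — lens decomp v10 ROW REC-INST, EDITION-FREE: module 31b's `hrep`-free road-(i)-dressed N19 edge at ANY datum whose averaging is the
# record's (`D.av K = avOfRecord F N K`), with the canonical unit factorisation, the TOP slot depth and t4's NAMED bond equivalence INSTANTIATED — the binders `Nf`, `kA`, `kB`, `εA`,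
# `εB`, `hAA`, `hAB` of `…_unitReading` are GONE (lens residual-obligation table R3 «DISCHARGEABLE TODAY»; R2 = kill-test (k3)); the instance at NODE 00's Stage-13 datum of record
# is ONE further line (`hav := Node00.av_datumOfRecord₁₃… := rfl` at the edition of record) — APPEND-ONLY §2 when def-T's v1.5 FILE 23 `Node00/Record13CoP.lean` lands (director-ym №160)

Cell `pub-ymgap` (HUMAN RULING D-0062, Track A), R134 ACCELERATION seat `pub-ymgap-dag-n19-d` (strategy s2 «by-name knit at the record»), gen 8, module 32.  PROVENANCE: lens decomp
v9 ROW REP-REC (bus l.17426) → my modules 31 `…N19ClassMeasurePushforward` (p509810) ∕ 31b `…N19LedgerDressAtRecordUnit` (p510641) → lens v10 ∕ v10.2 (HOME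
`ym-lens-BalabanUVNodes-decomp/LENS-decomp.md` §v10.1 table, rows R2 ∕ R3; session check `lean/LensDecompNE7v10recinst.check.lean`: «ROW REC-INST, optional three lines, valid
verbatim at every edition of the datum whose `av` is `avOfRecord` by `rfl`»).  EDITION POLICY (director-ym №152 (β) ∕ №160 (F7 adopted, Q1 = YES, HOLD-ALL, EDITION FREEZE) + my CHOICE-160 (5) bus l.18261, case (ii)):
this file reads NO record edition (only `avOfRecord`, F3's 12a-free step weights `wOfRecord₉` and module 31b), so it is filed NOW and survives v1.4 → v1.5 (`CoP`) unchanged; NO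
Co-keyed instance is filed (nothing keys on `Co` after rev 20); the v1.5 instance `coreEdge_classWeightOfDatum₉_datumOfRecord₁₃CoP_of_vacuumLedgerAtSync` (§1 at `D :=
Node00.datumOfRecord₁₃CoP F N θ h`, `hav := av_datumOfRecord₁₃CoP`) is appended as §2 when FILE 23 lands.  Filed `--kind proof --supports stmt-QuantumFields-20292 --as helper` (K3⁗
until KEY-20 ∕ WORDS-141).  COUNT-NEUTRAL.  THEOREMS ONLY; no Theses import (restate-immune); edits nothing; imports module 31b ONLY.
v1.1 (APPEND-ONLY, same day): §2 = that instance, on def-T's FILE 23 `Node00/Record13CoP.lean` p520810 ✓ (one more import; §1 byte-identical).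
v1.2 (APPEND-ONLY): §3 = the v1.6 instance at `datumOfRecord₁₃CoPR` (def-T FILE 25 p529474 ✓, KEY-RULE-25: `θ : Stage13RParams`, key `Provisos₁₃CoPR`); §1∕§2 byte-identical.

WHAT IS PROVED ([bookkeeping]).
* §1 ★ `coreEdge_classWeightOfDatum₉_of_vacuumLedgerAtSync_avOfRecord` — 31b §2 `coreEdge_classWeightOfDatum₉_of_vacuumLedgerAtSync_unitReading` at ANY datum `D` with
  `hav : ∀ K, D.av K = avOfRecord F N K`, with `Nf := T4RunLadder.unitFactorisation D hD g₀`, slot depths `kX K := (pX K).K` (the top depth — the only one at which the unit lattice and the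
  run's level-`(pX K).K` lattice have matching bond sets, lens v10 F17), `εX K := T4LevelShift.bondShift (T4LevelShift.sitesPerDir_unit F (pX K).K)` and `hAX := 31b §0
  unitFactorisation_A_eq_relabel_iter … (hav _)`: NODE O's synchronised VACUUM ledger on the undressed class weights of `D` (reference measure = unit-lattice Haar on the good classes,
  `hμ`), the in-edges BY NAME (N16 ∕ N18 ∕ N22 + fading memory ∕ U2's injected rate ∕ `LipBackground` ∕ `PolyLipGrowth`), and the two a.e. identifications `hdensA` ∕ `hdensB` of the
  ledger integrands with def-T's vacuum class densities read through the NAMED relabellings ⇒ `∃ δ, Spine.NE7.Core … (dressed class weights of D, run A) (run B) δ ∧ Summable δ`.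
  Seven binders of 31b §2 fewer (one `hav` more); every remaining binder is NODE O's instance (`hL`, `hμ`, `hdensA∕B` + measurability ∕ nonnegativity of its integrands), another
  node's estimate, or a letter.  `ϑ : Stage9Params F N` (F3's step weights `wOfRecord₉ ϑ` dressing the slots) stays free as in 31b.

HONEST FRAMING.  ZERO ESTIMATE CONTENT (instantiation of displayed binders by `rfl`-grade tree facts); the vacuum ledger `hL`, `hμ`, `hdensA∕B` are HYPOTHESES — NODE O's
`LedgerDataSync` instance at the carriers of record is inhabited by nobody in the tree (0∕1); valid at the identity selector (`hsel`); nothing of Bałaban's asserted; NE7 NOT PRINTED for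
d = 4, NOT proved; N19 NOT discharged; K3⁗ NOT claimed; no record inhabitant claimed; counts UNMOVED (typed 28∕28 · discharged 5∕27, A 5∕28); one finite four-torus programme at
fixed `ε = L^{−K}` — NOT ℝ⁴, NOT infinite volume, NOT OS, NOT a mass gap, NOT Clay.  0 `def`, 0 `sorry`; no decl below carries a cite tag (bookkeeping [folklore]).
-/

set_option autoImplicit false

noncomputable section

open Finset MeasureTheory ProbabilityTheory
open scoped BigOperators ENNReal Matrix.Norms.L2Operator

namespace Summit.QuantumFields.YangMills.BalabanUVNodes.N19LedgerDressAtRecordDatum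

open Literature.MathematicalPhysics.QuantumFieldTheory.Balaban1983to89
open Literature.MathematicalPhysics.QuantumFieldTheory.Balaban1983to89.Node00
open T4Continuum B14.Eq218Concrete
open T4AveragingDisintegration hiding SU
open T4OutputRate T4RecentScale T4GoodClassBudget T4CauchySum T4TowerRateComposition T4TowerRateDischarge
open T4EtaRateMin (Readings NE3Shape)
open T4RateLiaison (GaugeDominated)
open Summit.QuantumFields.BalabanUV.T4Continuum.Spine
open Summit.QuantumFields.YangMills.BalabanUVNodes.N19MGFKernelTower (slotMeasure)
open Summit.QuantumFields.YangMills.BalabanUVNodes.N19LedgerLinkSync (LedgerDataSync LedgerAtSync)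
open Summit.QuantumFields.YangMills.BalabanUVNodes.N19LedgerDressAtRecordUnit
  (unitFactorisation_A_eq_relabel_iter coreEdge_classWeightOfDatum₉_of_vacuumLedgerAtSync_unitReading)

variable {F : T4Family} {N : ℕ} [NeZero N]

/-! ## §1 ROW REC-INST, edition-free: 31b's `hrep`-free road-(i)-dressed edge with `Nf` ∕ `kX` ∕ `εX` ∕ `hAX` instantiated, at any datum with the record's averaging -/

section Edge

variable {C : Carriers} [DecidableEq C.Dom] {F' : Type*} {X : Type} {σ : Type*} [DecidableEq σ]
  {L : LedgerDataSync C F' (GaugeField (F.P 0) 0 (SU N)) σ} {l₀ vol : ℝ} {T : ℕ → Finset σ} {Bad : ℕ → ℝ → Finset σ}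
  {R : Readings (GaugeField (F.P 0) 0 (SU N)) X} {W : Set (ℕ → ℝ)} {EA : Functional C C.BgA} {EB : Functional C C.BgB}
  {κ θ₅ C₅ C₉ ω θc Cd γ C₃ θ₃ Pg : ℝ} {q : ℕ} {Λm : ℕ → ℕ → ℝ} {CU : (ℕ → ℝ) → ℕ → ℝ}
  {gc : ℕ → ℕ → ℝ} {uA : ℕ → GaugeField (F.P 0) 0 (SU N) → C.BgA} {uB : ℕ → GaugeField (F.P 0) 0 (SU N) → C.BgB}

/-- **★ ROW REC-INST, EDITION-FREE — THE `hrep`-FREE ROAD-(i)-DRESSED N19 EDGE FOR F3's CLASS WEIGHTS AT ANY DATUM WITH THE RECORD's AVERAGING** [bookkeeping] (lens v10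
R3; 31b §2 `coreEdge_classWeightOfDatum₉_of_vacuumLedgerAtSync_unitReading` with `Nf := T4RunLadder.unitFactorisation D hD g₀`, `kX K := (pX K).K`, `εX K := bondShift (sitesPerDir_unit F
(pX K).K)`, `hAX := 31b §0 … (hav _)`): for `D` with `hav : ∀ K, D.av K = avOfRecord F N K` (every edition's datum of record: `rfl`) — NODE O's synchronised VACUUM ledger on the undressed
class weights of `D` (`hL`; reference measure on the good classes = the unit-lattice Haar measure, `hμ`), the in-edges BY NAME, and the a.e. identifications `hdensA` ∕ `hdensB` of the
ledger integrands with def-T's vacuum class densities at the top slot depth read through the named relabellings (+ measurability ∕ nonnegativity) ⇒ `∃ δ, Spine.NE7.Core l₀ vol T Bad P Q δ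
∧ Summable δ` for the DRESSED class weights of `D`.  Every binder a HYPOTHESIS (0∕1); NOT NE7. [folklore] -/
theorem coreEdge_classWeightOfDatum₉_of_vacuumLedgerAtSync_avOfRecord (ϑ : Stage9Params F N) (hsel : ϑ.ppSel = ppSelIdOfRecord F ϑ.ν ϑ.τ9.M)
    (hw0 : ∀ p g k s' U V', 0 ≤ wOfRecord₉ F N ϑ p g k s' U V')
    (hwm : ∀ (p : B12.RunParams) (g : ℕ → ℝ) k s',
      Measurable fun z : GaugeField (F.P p.K) (k + 1) (SU N) × GaugeField (F.P p.K) k (SU N) => wOfRecord₉ F N ϑ p g k s' z.2 z.1)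
    (hχm : ∀ (p : B12.RunParams) (g : ℕ → ℝ) k s, Measurable (chiSeqOfRecord F N ϑ.ν ϑ.τ9.M g p.K k s))
    (D : FiniteEpsData F (SU N)) (hD : D.AvgMeasurable) (hav : ∀ K, D.av K = avOfRecord F N K) (g₀ : ℕ → ℝ) (os : List (ULoop F))
    (pA pB : ℕ → B12.RunParams) (gA gB : ℕ → ℕ → ℝ)
    (eA : ∀ K, σ → SeqOfRecord F ϑ.ν ϑ.τ9.M (gA K) (pA K).K (pA K).K) (eB : ∀ K, σ → SeqOfRecord F ϑ.ν ϑ.τ9.M (gB K) (pB K).K (pB K).K)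
    (hL : LedgerAtSync L l₀ vol T Bad (fun K _ τ => classWeightOfDatum₉ F N ϑ D g₀ os (pA K) (gA K) (pA K).K 0 (eA K τ))
      (fun K _ τ => classWeightOfDatum₉ F N ϑ D g₀ os (pB K) (gB K) (pB K).K 0 (eB K τ)) R EA EB κ gc uA uB ω θc θ₅ θ₃)
    (h16 : NE3Shape R C₃ θ₃) (hC₃ : 0 ≤ C₃) (hgd : GaugeDominated R uA uB)
    (h18 : NE5 EA EB W κ θ₅ C₅) (hθ₅ : 0 ≤ θ₅) (hC₅ : 0 ≤ C₅)
    (h22 : NE9 EA W κ Λm ∧ T4OutputRate.FadingMemory C₉ ω Λm) (hω : 0 ≤ ω)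
    (hinj : InjectedRate Cd 0 θc (fun K j => T4CouplingMatching.disc (gc K) (gc (K + 1)) j)) (hCd : 0 ≤ Cd)
    (hθc : 0 ≤ θc) (hbox : ∀ K i, i ≤ K → 0 < gc K i ∧ gc K i ≤ γ)
    (hU : LipBackground EA W κ CU) (hG : PolyLipGrowth CU gc Pg q) (hPg : 0 ≤ Pg)
    (hgA : ∀ K, gc K ∈ W) (hgB : ∀ K, (fun i => gc (K + 1) (i + 1)) ∈ W)
    (hμ : ∀ K t, |t| ≤ l₀ → ∀ τ ∈ T K \ Bad K t, L.μ K t τ = fieldMeasure (F.P 0) 0 (SU N))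
    (hfmA : ∀ K t, |t| ≤ l₀ → ∀ τ ∈ T K \ Bad K t,
      Measurable fun v => (∏ Xd ∈ L.fac K t τ, Real.exp (EA (gc K) (uA K v) Xd - EA (gc K) L.oneA Xd)) * L.oA K t τ v)
    (hf0A : ∀ K t, |t| ≤ l₀ → ∀ τ ∈ T K \ Bad K t, ∀ v,
      0 ≤ (∏ Xd ∈ L.fac K t τ, Real.exp (EA (gc K) (uA K v) Xd - EA (gc K) L.oneA Xd)) * L.oA K t τ v)
    (hdensA : ∀ K t, |t| ≤ l₀ → ∀ τ ∈ T K \ Bad K t,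
      (fun v => (∏ Xd ∈ L.fac K t τ, Real.exp (EA (gc K) (uA K v) Xd - EA (gc K) L.oneA Xd)) * L.oA K t τ v)
        =ᵐ[fieldMeasure (F.P 0) 0 (SU N)] fun V' =>
          (ENNReal.ofReal (chiSeqOfRecord F N ϑ.ν ϑ.τ9.M (gA K) (pA K).K (pA K).K (eA K τ)
              (relabel (T4LevelShift.bondShift (T4LevelShift.sitesPerDir_unit F (pA K).K)).symm V')) *
            slotMeasure F N ϑ.ν ϑ.τ9 (wOfRecord₉ F N ϑ) (pA K) (gA K) (Missing.boltzmann (F.P (pA K).K) ((g₀ (pA K).K)⁻¹ ^ 2)) (pA K).K (eA K τ)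
              (relabel (T4LevelShift.bondShift (T4LevelShift.sitesPerDir_unit F (pA K).K)).symm V') Set.univ).toReal)
    (hfmB : ∀ K t, |t| ≤ l₀ → ∀ τ ∈ T K \ Bad K t,
      Measurable fun v => (∏ Xd ∈ L.fac K t τ,
        Real.exp (EB (fun i => gc (K + 1) (i + 1)) (uB K v) Xd - EB (fun i => gc (K + 1) (i + 1)) L.oneB Xd)) * L.oB K t τ v)
    (hf0B : ∀ K t, |t| ≤ l₀ → ∀ τ ∈ T K \ Bad K t, ∀ v,
      0 ≤ (∏ Xd ∈ L.fac K t τ,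
        Real.exp (EB (fun i => gc (K + 1) (i + 1)) (uB K v) Xd - EB (fun i => gc (K + 1) (i + 1)) L.oneB Xd)) * L.oB K t τ v)
    (hdensB : ∀ K t, |t| ≤ l₀ → ∀ τ ∈ T K \ Bad K t,
      (fun v => (∏ Xd ∈ L.fac K t τ,
          Real.exp (EB (fun i => gc (K + 1) (i + 1)) (uB K v) Xd - EB (fun i => gc (K + 1) (i + 1)) L.oneB Xd)) * L.oB K t τ v)
        =ᵐ[fieldMeasure (F.P 0) 0 (SU N)] fun V' =>
          (ENNReal.ofReal (chiSeqOfRecord F N ϑ.ν ϑ.τ9.M (gB K) (pB K).K (pB K).K (eB K τ)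
              (relabel (T4LevelShift.bondShift (T4LevelShift.sitesPerDir_unit F (pB K).K)).symm V')) *
            slotMeasure F N ϑ.ν ϑ.τ9 (wOfRecord₉ F N ϑ) (pB K) (gB K) (Missing.boltzmann (F.P (pB K).K) ((g₀ (pB K).K)⁻¹ ^ 2)) (pB K).K (eB K τ)
              (relabel (T4LevelShift.bondShift (T4LevelShift.sitesPerDir_unit F (pB K).K)).symm V') Set.univ).toReal) :
    ∃ δ : ℕ → ℝ, NE7.Core l₀ vol T Bad
      (fun K t τ => classWeightOfDatum₉ F N ϑ D g₀ os (pA K) (gA K) (pA K).K t (eA K τ))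
      (fun K t τ => classWeightOfDatum₉ F N ϑ D g₀ os (pB K) (gB K) (pB K).K t (eB K τ)) δ ∧ Summable δ :=
  coreEdge_classWeightOfDatum₉_of_vacuumLedgerAtSync_unitReading ϑ hsel hw0 hwm hχm D hD g₀ os (T4RunLadder.unitFactorisation D hD g₀)
    pA pB gA gB (fun K => (pA K).K) (fun K => (pB K).K) eA eB hL h16 hC₃ hgd h18 hθ₅ hC₅ h22 hω hinj hCd hθc hbox hU hG hPg hgA hgB hμ
    (fun K => T4LevelShift.bondShift (T4LevelShift.sitesPerDir_unit F (pA K).K))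
    (fun K => T4LevelShift.bondShift (T4LevelShift.sitesPerDir_unit F (pB K).K))
    (fun K => unitFactorisation_A_eq_relabel_iter D hD g₀ (pA K).K (hav _))
    (fun K => unitFactorisation_A_eq_relabel_iter D hD g₀ (pB K).K (hav _))
    hfmA hf0A hdensA hfmB hf0B hdensB



/-! ## §2 (v1.1, APPEND-ONLY) The instance at NODE 00's v1.5 Stage-13 datum of record `Node00.datumOfRecord₁₃CoP` (def-T FILE 23 `Node00/Record13CoP.lean` p520810; director-ym №160∕№162) -/

/-- **ROW REC-INST AT THE v1.5 (`CoP`) DATUM OF RECORD** [bookkeeping]: §1 at `D := Node00.datumOfRecord₁₃CoP F N θ h`, `hD := (isPrintedAveraged_datumOfRecord₁₃CoP …).avgMeasurable`,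
`hav := av_datumOfRecord₁₃CoP` (`rfl`) — keyed `(θ, h : θ.Provisos₁₃Core F N)` (token-identical under v1.5, def-T Q1 l.18319); `ϑ := θ.toStage9Params` is the record's own weights. [folklore] -/
theorem coreEdge_classWeightOfDatum₉_datumOfRecord₁₃CoP_of_vacuumLedgerAtSync (ϑ : Stage9Params F N) (hsel : ϑ.ppSel = ppSelIdOfRecord F ϑ.ν ϑ.τ9.M)
    (hw0 : ∀ p g k s' U V', 0 ≤ wOfRecord₉ F N ϑ p g k s' U V')
    (hwm : ∀ (p : B12.RunParams) (g : ℕ → ℝ) k s',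
      Measurable fun z : GaugeField (F.P p.K) (k + 1) (SU N) × GaugeField (F.P p.K) k (SU N) => wOfRecord₉ F N ϑ p g k s' z.2 z.1)
    (hχm : ∀ (p : B12.RunParams) (g : ℕ → ℝ) k s, Measurable (chiSeqOfRecord F N ϑ.ν ϑ.τ9.M g p.K k s))
    (θ : Stage13Params F N) (h : θ.Provisos₁₃Core F N) (g₀ : ℕ → ℝ) (os : List (ULoop F))
    (pA pB : ℕ → B12.RunParams) (gA gB : ℕ → ℕ → ℝ)
    (eA : ∀ K, σ → SeqOfRecord F ϑ.ν ϑ.τ9.M (gA K) (pA K).K (pA K).K) (eB : ∀ K, σ → SeqOfRecord F ϑ.ν ϑ.τ9.M (gB K) (pB K).K (pB K).K)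
    (hL : LedgerAtSync L l₀ vol T Bad (fun K _ τ => classWeightOfDatum₉ F N ϑ (datumOfRecord₁₃CoP F N θ h) g₀ os (pA K) (gA K) (pA K).K 0 (eA K τ))
      (fun K _ τ => classWeightOfDatum₉ F N ϑ (datumOfRecord₁₃CoP F N θ h) g₀ os (pB K) (gB K) (pB K).K 0 (eB K τ)) R EA EB κ gc uA uB ω θc θ₅ θ₃)
    (h16 : NE3Shape R C₃ θ₃) (hC₃ : 0 ≤ C₃) (hgd : GaugeDominated R uA uB)
    (h18 : NE5 EA EB W κ θ₅ C₅) (hθ₅ : 0 ≤ θ₅) (hC₅ : 0 ≤ C₅)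
    (h22 : NE9 EA W κ Λm ∧ T4OutputRate.FadingMemory C₉ ω Λm) (hω : 0 ≤ ω)
    (hinj : InjectedRate Cd 0 θc (fun K j => T4CouplingMatching.disc (gc K) (gc (K + 1)) j)) (hCd : 0 ≤ Cd)
    (hθc : 0 ≤ θc) (hbox : ∀ K i, i ≤ K → 0 < gc K i ∧ gc K i ≤ γ)
    (hU : LipBackground EA W κ CU) (hG : PolyLipGrowth CU gc Pg q) (hPg : 0 ≤ Pg)
    (hgA : ∀ K, gc K ∈ W) (hgB : ∀ K, (fun i => gc (K + 1) (i + 1)) ∈ W)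
    (hμ : ∀ K t, |t| ≤ l₀ → ∀ τ ∈ T K \ Bad K t, L.μ K t τ = fieldMeasure (F.P 0) 0 (SU N))
    (hfmA : ∀ K t, |t| ≤ l₀ → ∀ τ ∈ T K \ Bad K t,
      Measurable fun v => (∏ Xd ∈ L.fac K t τ, Real.exp (EA (gc K) (uA K v) Xd - EA (gc K) L.oneA Xd)) * L.oA K t τ v)
    (hf0A : ∀ K t, |t| ≤ l₀ → ∀ τ ∈ T K \ Bad K t, ∀ v,
      0 ≤ (∏ Xd ∈ L.fac K t τ, Real.exp (EA (gc K) (uA K v) Xd - EA (gc K) L.oneA Xd)) * L.oA K t τ v)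
    (hdensA : ∀ K t, |t| ≤ l₀ → ∀ τ ∈ T K \ Bad K t,
      (fun v => (∏ Xd ∈ L.fac K t τ, Real.exp (EA (gc K) (uA K v) Xd - EA (gc K) L.oneA Xd)) * L.oA K t τ v)
        =ᵐ[fieldMeasure (F.P 0) 0 (SU N)] fun V' =>
          (ENNReal.ofReal (chiSeqOfRecord F N ϑ.ν ϑ.τ9.M (gA K) (pA K).K (pA K).K (eA K τ)
              (relabel (T4LevelShift.bondShift (T4LevelShift.sitesPerDir_unit F (pA K).K)).symm V')) *
            slotMeasure F N ϑ.ν ϑ.τ9 (wOfRecord₉ F N ϑ) (pA K) (gA K) (Missing.boltzmann (F.P (pA K).K) ((g₀ (pA K).K)⁻¹ ^ 2)) (pA K).K (eA K τ)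
              (relabel (T4LevelShift.bondShift (T4LevelShift.sitesPerDir_unit F (pA K).K)).symm V') Set.univ).toReal)
    (hfmB : ∀ K t, |t| ≤ l₀ → ∀ τ ∈ T K \ Bad K t,
      Measurable fun v => (∏ Xd ∈ L.fac K t τ,
        Real.exp (EB (fun i => gc (K + 1) (i + 1)) (uB K v) Xd - EB (fun i => gc (K + 1) (i + 1)) L.oneB Xd)) * L.oB K t τ v)
    (hf0B : ∀ K t, |t| ≤ l₀ → ∀ τ ∈ T K \ Bad K t, ∀ v,
      0 ≤ (∏ Xd ∈ L.fac K t τ,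
        Real.exp (EB (fun i => gc (K + 1) (i + 1)) (uB K v) Xd - EB (fun i => gc (K + 1) (i + 1)) L.oneB Xd)) * L.oB K t τ v)
    (hdensB : ∀ K t, |t| ≤ l₀ → ∀ τ ∈ T K \ Bad K t,
      (fun v => (∏ Xd ∈ L.fac K t τ,
          Real.exp (EB (fun i => gc (K + 1) (i + 1)) (uB K v) Xd - EB (fun i => gc (K + 1) (i + 1)) L.oneB Xd)) * L.oB K t τ v)
        =ᵐ[fieldMeasure (F.P 0) 0 (SU N)] fun V' =>
          (ENNReal.ofReal (chiSeqOfRecord F N ϑ.ν ϑ.τ9.M (gB K) (pB K).K (pB K).K (eB K τ)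
              (relabel (T4LevelShift.bondShift (T4LevelShift.sitesPerDir_unit F (pB K).K)).symm V')) *
            slotMeasure F N ϑ.ν ϑ.τ9 (wOfRecord₉ F N ϑ) (pB K) (gB K) (Missing.boltzmann (F.P (pB K).K) ((g₀ (pB K).K)⁻¹ ^ 2)) (pB K).K (eB K τ)
              (relabel (T4LevelShift.bondShift (T4LevelShift.sitesPerDir_unit F (pB K).K)).symm V') Set.univ).toReal) :
    ∃ δ : ℕ → ℝ, NE7.Core l₀ vol T Bad
      (fun K t τ => classWeightOfDatum₉ F N ϑ (datumOfRecord₁₃CoP F N θ h) g₀ os (pA K) (gA K) (pA K).K t (eA K τ))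
      (fun K t τ => classWeightOfDatum₉ F N ϑ (datumOfRecord₁₃CoP F N θ h) g₀ os (pB K) (gB K) (pB K).K t (eB K τ)) δ ∧ Summable δ :=
  coreEdge_classWeightOfDatum₉_of_vacuumLedgerAtSync_avOfRecord ϑ hsel hw0 hwm hχm (datumOfRecord₁₃CoP F N θ h)
    (Node00.isPrintedAveraged_datumOfRecord₁₃CoP F N θ h).avgMeasurable (fun K => by rw [Node00.av_datumOfRecord₁₃CoP]) g₀ os
    pA pB gA gB eA eB hL h16 hC₃ hgd h18 hθ₅ hC₅ h22 hω hinj hCd hθc hbox hU hG hPg hgA hgB hμ hfmA hf0A hdensA hfmB hf0B hdensB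

/-! ## §3 (v1.2, APPEND-ONLY) The instance at NODE 00's v1.6 Stage-13 datum of record `Node00.datumOfRecord₁₃CoPR` (def-T FILE 25 `Node00/Record13CoPR.lean` p529474; FINDING №8, director-ym №169∕№174) -/

/-- **ROW REC-INST AT THE v1.6 (`CoPR`, run-indexed residual 𝐓-weights) DATUM OF RECORD** [bookkeeping]: §1 at `D := Node00.datumOfRecord₁₃CoPR F N θ h`, `hD := (isPrintedAveraged_datumOfRecord₁₃CoPR …).avgMeasurable`,
`hav := av_datumOfRecord₁₃CoPR` (`rfl`) — keyed `(θ : Stage13RParams, h : θ.Provisos₁₃CoPR F N)` (KEY-RULE-25); `ϑ := θ.toStage9Params` is the record's own weights. [folklore] -/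
theorem coreEdge_classWeightOfDatum₉_datumOfRecord₁₃CoPR_of_vacuumLedgerAtSync (ϑ : Stage9Params F N) (hsel : ϑ.ppSel = ppSelIdOfRecord F ϑ.ν ϑ.τ9.M)
    (hw0 : ∀ p g k s' U V', 0 ≤ wOfRecord₉ F N ϑ p g k s' U V')
    (hwm : ∀ (p : B12.RunParams) (g : ℕ → ℝ) k s',
      Measurable fun z : GaugeField (F.P p.K) (k + 1) (SU N) × GaugeField (F.P p.K) k (SU N) => wOfRecord₉ F N ϑ p g k s' z.2 z.1)
    (hχm : ∀ (p : B12.RunParams) (g : ℕ → ℝ) k s, Measurable (chiSeqOfRecord F N ϑ.ν ϑ.τ9.M g p.K k s))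
    (θ : Stage13RParams F N) (h : θ.Provisos₁₃CoPR F N) (g₀ : ℕ → ℝ) (os : List (ULoop F))
    (pA pB : ℕ → B12.RunParams) (gA gB : ℕ → ℕ → ℝ)
    (eA : ∀ K, σ → SeqOfRecord F ϑ.ν ϑ.τ9.M (gA K) (pA K).K (pA K).K) (eB : ∀ K, σ → SeqOfRecord F ϑ.ν ϑ.τ9.M (gB K) (pB K).K (pB K).K)
    (hL : LedgerAtSync L l₀ vol T Bad (fun K _ τ => classWeightOfDatum₉ F N ϑ (datumOfRecord₁₃CoPR F N θ h) g₀ os (pA K) (gA K) (pA K).K 0 (eA K τ))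
      (fun K _ τ => classWeightOfDatum₉ F N ϑ (datumOfRecord₁₃CoPR F N θ h) g₀ os (pB K) (gB K) (pB K).K 0 (eB K τ)) R EA EB κ gc uA uB ω θc θ₅ θ₃)
    (h16 : NE3Shape R C₃ θ₃) (hC₃ : 0 ≤ C₃) (hgd : GaugeDominated R uA uB)
    (h18 : NE5 EA EB W κ θ₅ C₅) (hθ₅ : 0 ≤ θ₅) (hC₅ : 0 ≤ C₅)
    (h22 : NE9 EA W κ Λm ∧ T4OutputRate.FadingMemory C₉ ω Λm) (hω : 0 ≤ ω)
    (hinj : InjectedRate Cd 0 θc (fun K j => T4CouplingMatching.disc (gc K) (gc (K + 1)) j)) (hCd : 0 ≤ Cd)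
    (hθc : 0 ≤ θc) (hbox : ∀ K i, i ≤ K → 0 < gc K i ∧ gc K i ≤ γ)
    (hU : LipBackground EA W κ CU) (hG : PolyLipGrowth CU gc Pg q) (hPg : 0 ≤ Pg)
    (hgA : ∀ K, gc K ∈ W) (hgB : ∀ K, (fun i => gc (K + 1) (i + 1)) ∈ W)
    (hμ : ∀ K t, |t| ≤ l₀ → ∀ τ ∈ T K \ Bad K t, L.μ K t τ = fieldMeasure (F.P 0) 0 (SU N))
    (hfmA : ∀ K t, |t| ≤ l₀ → ∀ τ ∈ T K \ Bad K t,
      Measurable fun v => (∏ Xd ∈ L.fac K t τ, Real.exp (EA (gc K) (uA K v) Xd - EA (gc K) L.oneA Xd)) * L.oA K t τ v)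
    (hf0A : ∀ K t, |t| ≤ l₀ → ∀ τ ∈ T K \ Bad K t, ∀ v,
      0 ≤ (∏ Xd ∈ L.fac K t τ, Real.exp (EA (gc K) (uA K v) Xd - EA (gc K) L.oneA Xd)) * L.oA K t τ v)
    (hdensA : ∀ K t, |t| ≤ l₀ → ∀ τ ∈ T K \ Bad K t,
      (fun v => (∏ Xd ∈ L.fac K t τ, Real.exp (EA (gc K) (uA K v) Xd - EA (gc K) L.oneA Xd)) * L.oA K t τ v)
        =ᵐ[fieldMeasure (F.P 0) 0 (SU N)] fun V' =>
          (ENNReal.ofReal (chiSeqOfRecord F N ϑ.ν ϑ.τ9.M (gA K) (pA K).K (pA K).K (eA K τ)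
              (relabel (T4LevelShift.bondShift (T4LevelShift.sitesPerDir_unit F (pA K).K)).symm V')) *
            slotMeasure F N ϑ.ν ϑ.τ9 (wOfRecord₉ F N ϑ) (pA K) (gA K) (Missing.boltzmann (F.P (pA K).K) ((g₀ (pA K).K)⁻¹ ^ 2)) (pA K).K (eA K τ)
              (relabel (T4LevelShift.bondShift (T4LevelShift.sitesPerDir_unit F (pA K).K)).symm V') Set.univ).toReal)
    (hfmB : ∀ K t, |t| ≤ l₀ → ∀ τ ∈ T K \ Bad K t,
      Measurable fun v => (∏ Xd ∈ L.fac K t τ,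
        Real.exp (EB (fun i => gc (K + 1) (i + 1)) (uB K v) Xd - EB (fun i => gc (K + 1) (i + 1)) L.oneB Xd)) * L.oB K t τ v)
    (hf0B : ∀ K t, |t| ≤ l₀ → ∀ τ ∈ T K \ Bad K t, ∀ v,
      0 ≤ (∏ Xd ∈ L.fac K t τ,
        Real.exp (EB (fun i => gc (K + 1) (i + 1)) (uB K v) Xd - EB (fun i => gc (K + 1) (i + 1)) L.oneB Xd)) * L.oB K t τ v)
    (hdensB : ∀ K t, |t| ≤ l₀ → ∀ τ ∈ T K \ Bad K t,
      (fun v => (∏ Xd ∈ L.fac K t τ,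
          Real.exp (EB (fun i => gc (K + 1) (i + 1)) (uB K v) Xd - EB (fun i => gc (K + 1) (i + 1)) L.oneB Xd)) * L.oB K t τ v)
        =ᵐ[fieldMeasure (F.P 0) 0 (SU N)] fun V' =>
          (ENNReal.ofReal (chiSeqOfRecord F N ϑ.ν ϑ.τ9.M (gB K) (pB K).K (pB K).K (eB K τ)
              (relabel (T4LevelShift.bondShift (T4LevelShift.sitesPerDir_unit F (pB K).K)).symm V')) *
            slotMeasure F N ϑ.ν ϑ.τ9 (wOfRecord₉ F N ϑ) (pB K) (gB K) (Missing.boltzmann (F.P (pB K).K) ((g₀ (pB K).K)⁻¹ ^ 2)) (pB K).K (eB K τ)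
              (relabel (T4LevelShift.bondShift (T4LevelShift.sitesPerDir_unit F (pB K).K)).symm V') Set.univ).toReal) :
    ∃ δ : ℕ → ℝ, NE7.Core l₀ vol T Bad
      (fun K t τ => classWeightOfDatum₉ F N ϑ (datumOfRecord₁₃CoPR F N θ h) g₀ os (pA K) (gA K) (pA K).K t (eA K τ))
      (fun K t τ => classWeightOfDatum₉ F N ϑ (datumOfRecord₁₃CoPR F N θ h) g₀ os (pB K) (gB K) (pB K).K t (eB K τ)) δ ∧ Summable δ :=
  coreEdge_classWeightOfDatum₉_of_vacuumLedgerAtSync_avOfRecord ϑ hsel hw0 hwm hχm (datumOfRecord₁₃CoPR F N θ h)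
    (Node00.isPrintedAveraged_datumOfRecord₁₃CoPR F N θ h).avgMeasurable (fun K => by rw [Node00.av_datumOfRecord₁₃CoPR]) g₀ os
    pA pB gA gB eA eB hL h16 hC₃ hgd h18 hθ₅ hC₅ h22 hω hinj hCd hθc hbox hU hG hPg hgA hgB hμ hfmA hf0A hdensA hfmB hf0B hdensB

/-! ## §4 (v1.3, APPEND-ONLY) The instance at NODE 00's v1.7 Stage-13 datum of record `Node00.datumOfRecord₁₃CoPH` (def-T FILE 27 `Node00/Record13CoPH.lean` p537939; FINDING №9, director-ym №183 H1ʰ∕№186 (α)∕№187) -/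

/-- **ROW REC-INST AT THE v1.7 (`CoPH`, level-indexed WHOLE-HISTORY residual 𝐓-weights) DATUM OF RECORD** [bookkeeping]: §1 at `D := Node00.datumOfRecord₁₃CoPH F N θ h`, `hD := (isPrintedAveraged_datumOfRecord₁₃CoPH …).avgMeasurable`,
`hav := av_datumOfRecord₁₃CoPH` (`rfl`) — keyed `(θ : Stage13HParams, h : θ.Provisos₁₃CoPH F N)` (KEY-RULE-27; not-re-issued letters — here `θ.toStage9Params` — through the two-level `extends`); `ϑ := θ.toStage9Params` is the record's own weights. [folklore] -/
theorem coreEdge_classWeightOfDatum₉_datumOfRecord₁₃CoPH_of_vacuumLedgerAtSync (ϑ : Stage9Params F N) (hsel : ϑ.ppSel = ppSelIdOfRecord F ϑ.ν ϑ.τ9.M)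
    (hw0 : ∀ p g k s' U V', 0 ≤ wOfRecord₉ F N ϑ p g k s' U V')
    (hwm : ∀ (p : B12.RunParams) (g : ℕ → ℝ) k s',
      Measurable fun z : GaugeField (F.P p.K) (k + 1) (SU N) × GaugeField (F.P p.K) k (SU N) => wOfRecord₉ F N ϑ p g k s' z.2 z.1)
    (hχm : ∀ (p : B12.RunParams) (g : ℕ → ℝ) k s, Measurable (chiSeqOfRecord F N ϑ.ν ϑ.τ9.M g p.K k s))
    (θ : Stage13HParams F N) (h : θ.Provisos₁₃CoPH F N) (g₀ : ℕ → ℝ) (os : List (ULoop F))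
    (pA pB : ℕ → B12.RunParams) (gA gB : ℕ → ℕ → ℝ)
    (eA : ∀ K, σ → SeqOfRecord F ϑ.ν ϑ.τ9.M (gA K) (pA K).K (pA K).K) (eB : ∀ K, σ → SeqOfRecord F ϑ.ν ϑ.τ9.M (gB K) (pB K).K (pB K).K)
    (hL : LedgerAtSync L l₀ vol T Bad (fun K _ τ => classWeightOfDatum₉ F N ϑ (datumOfRecord₁₃CoPH F N θ h) g₀ os (pA K) (gA K) (pA K).K 0 (eA K τ))
      (fun K _ τ => classWeightOfDatum₉ F N ϑ (datumOfRecord₁₃CoPH F N θ h) g₀ os (pB K) (gB K) (pB K).K 0 (eB K τ)) R EA EB κ gc uA uB ω θc θ₅ θ₃)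
    (h16 : NE3Shape R C₃ θ₃) (hC₃ : 0 ≤ C₃) (hgd : GaugeDominated R uA uB)
    (h18 : NE5 EA EB W κ θ₅ C₅) (hθ₅ : 0 ≤ θ₅) (hC₅ : 0 ≤ C₅)
    (h22 : NE9 EA W κ Λm ∧ T4OutputRate.FadingMemory C₉ ω Λm) (hω : 0 ≤ ω)
    (hinj : InjectedRate Cd 0 θc (fun K j => T4CouplingMatching.disc (gc K) (gc (K + 1)) j)) (hCd : 0 ≤ Cd)
    (hθc : 0 ≤ θc) (hbox : ∀ K i, i ≤ K → 0 < gc K i ∧ gc K i ≤ γ)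
    (hU : LipBackground EA W κ CU) (hG : PolyLipGrowth CU gc Pg q) (hPg : 0 ≤ Pg)
    (hgA : ∀ K, gc K ∈ W) (hgB : ∀ K, (fun i => gc (K + 1) (i + 1)) ∈ W)
    (hμ : ∀ K t, |t| ≤ l₀ → ∀ τ ∈ T K \ Bad K t, L.μ K t τ = fieldMeasure (F.P 0) 0 (SU N))
    (hfmA : ∀ K t, |t| ≤ l₀ → ∀ τ ∈ T K \ Bad K t,
      Measurable fun v => (∏ Xd ∈ L.fac K t τ, Real.exp (EA (gc K) (uA K v) Xd - EA (gc K) L.oneA Xd)) * L.oA K t τ v)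
    (hf0A : ∀ K t, |t| ≤ l₀ → ∀ τ ∈ T K \ Bad K t, ∀ v,
      0 ≤ (∏ Xd ∈ L.fac K t τ, Real.exp (EA (gc K) (uA K v) Xd - EA (gc K) L.oneA Xd)) * L.oA K t τ v)
    (hdensA : ∀ K t, |t| ≤ l₀ → ∀ τ ∈ T K \ Bad K t,
      (fun v => (∏ Xd ∈ L.fac K t τ, Real.exp (EA (gc K) (uA K v) Xd - EA (gc K) L.oneA Xd)) * L.oA K t τ v)
        =ᵐ[fieldMeasure (F.P 0) 0 (SU N)] fun V' =>
          (ENNReal.ofReal (chiSeqOfRecord F N ϑ.ν ϑ.τ9.M (gA K) (pA K).K (pA K).K (eA K τ)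
              (relabel (T4LevelShift.bondShift (T4LevelShift.sitesPerDir_unit F (pA K).K)).symm V')) *
            slotMeasure F N ϑ.ν ϑ.τ9 (wOfRecord₉ F N ϑ) (pA K) (gA K) (Missing.boltzmann (F.P (pA K).K) ((g₀ (pA K).K)⁻¹ ^ 2)) (pA K).K (eA K τ)
              (relabel (T4LevelShift.bondShift (T4LevelShift.sitesPerDir_unit F (pA K).K)).symm V') Set.univ).toReal)
    (hfmB : ∀ K t, |t| ≤ l₀ → ∀ τ ∈ T K \ Bad K t,
      Measurable fun v => (∏ Xd ∈ L.fac K t τ,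
        Real.exp (EB (fun i => gc (K + 1) (i + 1)) (uB K v) Xd - EB (fun i => gc (K + 1) (i + 1)) L.oneB Xd)) * L.oB K t τ v)
    (hf0B : ∀ K t, |t| ≤ l₀ → ∀ τ ∈ T K \ Bad K t, ∀ v,
      0 ≤ (∏ Xd ∈ L.fac K t τ,
        Real.exp (EB (fun i => gc (K + 1) (i + 1)) (uB K v) Xd - EB (fun i => gc (K + 1) (i + 1)) L.oneB Xd)) * L.oB K t τ v)
    (hdensB : ∀ K t, |t| ≤ l₀ → ∀ τ ∈ T K \ Bad K t,
      (fun v => (∏ Xd ∈ L.fac K t τ,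
          Real.exp (EB (fun i => gc (K + 1) (i + 1)) (uB K v) Xd - EB (fun i => gc (K + 1) (i + 1)) L.oneB Xd)) * L.oB K t τ v)
        =ᵐ[fieldMeasure (F.P 0) 0 (SU N)] fun V' =>
          (ENNReal.ofReal (chiSeqOfRecord F N ϑ.ν ϑ.τ9.M (gB K) (pB K).K (pB K).K (eB K τ)
              (relabel (T4LevelShift.bondShift (T4LevelShift.sitesPerDir_unit F (pB K).K)).symm V')) *
            slotMeasure F N ϑ.ν ϑ.τ9 (wOfRecord₉ F N ϑ) (pB K) (gB K) (Missing.boltzmann (F.P (pB K).K) ((g₀ (pB K).K)⁻¹ ^ 2)) (pB K).K (eB K τ)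
              (relabel (T4LevelShift.bondShift (T4LevelShift.sitesPerDir_unit F (pB K).K)).symm V') Set.univ).toReal) :
    ∃ δ : ℕ → ℝ, NE7.Core l₀ vol T Bad
      (fun K t τ => classWeightOfDatum₉ F N ϑ (datumOfRecord₁₃CoPH F N θ h) g₀ os (pA K) (gA K) (pA K).K t (eA K τ))
      (fun K t τ => classWeightOfDatum₉ F N ϑ (datumOfRecord₁₃CoPH F N θ h) g₀ os (pB K) (gB K) (pB K).K t (eB K τ)) δ ∧ Summable δ :=
  coreEdge_classWeightOfDatum₉_of_vacuumLedgerAtSync_avOfRecord ϑ hsel hw0 hwm hχm (datumOfRecord₁₃CoPH F N θ h)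
    (Node00.isPrintedAveraged_datumOfRecord₁₃CoPH F N θ h).avgMeasurable (fun K => by rw [Node00.av_datumOfRecord₁₃CoPH]) g₀ os
    pA pB gA gB eA eB hL h16 hC₃ hgd h18 hθ₅ hC₅ h22 hω hinj hCd hθc hbox hU hG hPg hgA hgB hμ hfmA hf0A hdensA hfmB hf0B hdensB

end Edge

end Summit.QuantumFields.YangMills.BalabanUVNodes.N19LedgerDressAtRecordDatum

end
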